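import Literature.NumberTheory.EllipticCurves.Greenberg1999.TwoTorsionLines
import Literature.NumberTheory.EllipticCurves.TateCurve.NumberField
import Literature.NumberTheory.EllipticCurves.TateCurve.UniformizationTransport
import Mathlib.Analysis.Normed.Unbundled.SpectralNorm
import Mathlib.RingTheory.RootsOfUnity.AlgebraicallyClosed
import Mathlib.FieldTheory.Galois.Infinite
import HarnessLib

/-!
# Rigidity of the `2`-torsion point `Ψ(-1)` of a twisted Tate parametrisation
# (toward the PROOF of `Greenberg1999.twoTorsion_mem_tateLine_iff_ramifiedAtTwo`)

Proof-only file (theorems, no definitions, no named facts). Setting: `K` a number field, `v` a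
finite place, `K_v = v.adicCompletion K`, `K̄_v = AlgebraicClosure K_v` with its `Γ = Gal(K̄_v/K_v)`
action, and two "twisted Tate parametrisations" with the clauses of Silverman, *Advanced Topics*,
Lemma V.5.2 (c) / Thm. V.5.3 / Cor. V.5.4 as they are recorded in the tree's named facts
`Silverman1994_thmV53_corV54_tateUniformisation` and
`Greenberg1999.twoTorsion_mem_tateLine_iff_ramifiedAtTwo`: homomorphisms `Ψ, Ψ₁ : K̄_vˣ → M` into a
`Γ`-module with kernels `q^ℤ`, `q₁^ℤ` (`0 < |q|, |q₁| < 1`) and the SAME sign character `ε`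
(`σ • Ψ(u) = ε(σ) Ψ(σ u)`), `Ψ₁` surjective.

Main result `twistedUniformisation_neg_one_eq`: if `K_v` contains no primitive `2^(n+1)`-th root
of unity (`z ^ 2 ^ n ≠ -1` in `K_v`), then `Ψ(-1) = Ψ₁(-1)` — the `μ₂`-point of the Tate line does
not depend on the parametrisation. This is the uniqueness of the Tate line `C_v ≅ μ_{2^∞}`
(Greenberg, LNM 1716, §2 p. 70 and §5 p. 168: "`C₂ ≅ μ_{2^∞}` for the action of `I_{ℚ₂}`"), proved
here by an elementary VALUATION argument instead of the Kummer class of `q`: write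
`Ψ(ζ) = Ψ₁(u)` for a primitive `2^(n+1)`-th root of unity `ζ`, so `u^(2^(n+1)) = q₁^m`; a `σ ∈ Γ`
with `σ ζ = ζ^e ≠ ζ` gives, by the common equivariance, `σ u = u^e q₁^k`; since `Γ` acts on `K̄_v`
by isometries of the spectral norm, `(e - 1)·m = -k·2^(n+1)` with `0 < |e - 1| < 2^(n+1)`, so `m`
is even, `u^(2^n) = ± q₁^(m/2)` and `Ψ(-1) = Ψ(ζ^(2^n)) = Ψ₁(u^(2^n)) = Ψ₁(-1)` (the sign `+`
would put `-1` in `q^ℤ`).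

References: [GreenbergLNM1716] R. Greenberg, *Iwasawa theory for elliptic curves*, LNM 1716
(1999), §2 p. 70, §5 pp. 168–176; [SilvermanATAEC1994] J. H. Silverman, *Advanced Topics in the
Arithmetic of Elliptic Curves*, GTM 151, Lemma V.5.2 (c), Thm. V.5.3, Cor. V.5.4 (PDF pp. 406–410).
-/

noncomputable section

open scoped Classical

open NumberField IsDedekindDomain Field

namespace Literature.NumberTheory.EllipticCurves.Greenberg1999

section Rigidity

variable {K : Type} [Field K] [NumberField K] (v : HeightOneSpectrum (𝓞 K))

/-- A primitive `2^(n+1)`-th root of unity `ζ` has `ζ ^ 2 ^ n = -1`. [folklore] -/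
private theorem pow_eq_neg_one_of_isPrimitiveRoot_two_pow_succ {R : Type*} [CommRing R] [IsDomain R]
    {n : ℕ} {ζ : R} (hζ : IsPrimitiveRoot ζ (2 ^ (n + 1))) : ζ ^ 2 ^ n = -1 := by
  have h := hζ.pow_of_dvd (p := 2 ^ n) (pow_ne_zero _ two_ne_zero) (Dvd.intro 2 (pow_succ 2 n).symm)
  rw [pow_succ, Nat.mul_div_cancel_left 2 (pow_pos two_pos n)] at h
  exact h.eq_neg_one_of_two_right

/-- If `K_v` contains no primitive `2^(n+1)`-th root of unity (no `z` with `z ^ 2 ^ n = -1`), then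
every primitive `2^(n+1)`-th root of unity of `K̄_v` is moved by some element of `Gal(K̄_v/K_v)`
(Galois descent: `K̄_v^Γ = K_v`). [folklore] -/
private theorem exists_toAlgEquiv_apply_ne_of_isPrimitiveRoot (n : ℕ)
    (hroot : ∀ z : v.adicCompletion K, z ^ 2 ^ n ≠ -1)
    {ζ : AlgebraicClosure (v.adicCompletion K)} (hζ : IsPrimitiveRoot ζ (2 ^ (n + 1))) :
    ∃ σ : absoluteGaloisGroup (v.adicCompletion K),
      absoluteGaloisGroup.toAlgEquiv (v.adicCompletion K) σ ζ ≠ ζ := by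
  haveI := TateCurve.charZero_adicCompletion' K v
  by_contra h
  push Not at h
  haveI : IsGalois (v.adicCompletion K) (AlgebraicClosure (v.adicCompletion K)) := {}
  obtain ⟨z, hz⟩ := (InfiniteGalois.mem_range_algebraMap_iff_fixed ζ).mpr fun f => by
    simpa using h ((absoluteGaloisGroup.toAlgEquiv (v.adicCompletion K)).symm f)
  apply hroot z
  apply (algebraMap (v.adicCompletion K) (AlgebraicClosure (v.adicCompletion K))).injective
  rw [map_pow, hz, pow_eq_neg_one_of_isPrimitiveRoot_two_pow_succ hζ, map_neg, map_one]

/-- **Rigidity of `Ψ(-1)`.** Let `Ψ, Ψ₁ : K̄_vˣ → M` be homomorphisms into a `Gal(K̄_v/K_v)`-module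
with kernels `q^ℤ`, `q₁^ℤ` (`q, q₁ ∈ K_v`, `q, q₁ ≠ 0`, `v(q), v(q₁) < 1`), both twisted-equivariant for
the SAME sign function `ε` (`σ • Ψ(u) = ε(σ) • Ψ(σ u)`, `ε(σ) = ±1`), with `Ψ₁` surjective — the
clauses of Silverman *ATAEC* Lemma V.5.2 (c) / Thm. V.5.3 / Cor. V.5.4 as recorded in
`Silverman1994_thmV53_corV54_tateUniformisation`. If `K_v` has no primitive `2^(n+1)`-th root of
unity, then `Ψ(-1) = Ψ₁(-1)`: the point of order `2` on the Tate line `Ψ(μ_{2^∞})` is independent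
of the parametrisation (Greenberg LNM 1716 §5: `C₂ ≅ μ_{2^∞}` is determined by the Galois action).
Proof by spectral-norm bookkeeping (module docstring).
[cite: GreenbergLNM1716, §2 p. 70 and §5 p. 168] [cite: SilvermanATAEC1994, Lemma V.5.2 (c), Thm. V.5.3] -/
theorem twistedUniformisation_neg_one_eq (n : ℕ)
    (hroot : ∀ z : v.adicCompletion K, z ^ 2 ^ n ≠ -1)
    {M : Type*} [AddCommGroup M] [SMul (absoluteGaloisGroup (v.adicCompletion K)) M]
    (ε : absoluteGaloisGroup (v.adicCompletion K) → ℤ) (hε : ∀ σ, ε σ = 1 ∨ ε σ = -1)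
    {q q₁ : v.adicCompletion K} (hq0 : q ≠ 0) (hq : Valued.v q < 1) (hq₁0 : q₁ ≠ 0)
    (hq₁ : Valued.v q₁ < 1)
    (Ψ Ψ₁ : Additive (AlgebraicClosure (v.adicCompletion K))ˣ →+ M)
    (hkerΨ : ∀ u : (AlgebraicClosure (v.adicCompletion K))ˣ, Ψ (Additive.ofMul u) = 0 ↔
      ∃ k : ℤ, (u : AlgebraicClosure (v.adicCompletion K)) =
        algebraMap (v.adicCompletion K) (AlgebraicClosure (v.adicCompletion K)) q ^ k)
    (hΨ : ∀ (σ : absoluteGaloisGroup (v.adicCompletion K))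
        (u : (AlgebraicClosure (v.adicCompletion K))ˣ),
      σ • Ψ (Additive.ofMul u) = ε σ • Ψ (Additive.ofMul (Units.map
        (absoluteGaloisGroup.toAlgEquiv (v.adicCompletion K) σ :
          AlgebraicClosure (v.adicCompletion K) →* AlgebraicClosure (v.adicCompletion K)) u)))
    (hsurj₁ : Function.Surjective Ψ₁)
    (hkerΨ₁ : ∀ u : (AlgebraicClosure (v.adicCompletion K))ˣ, Ψ₁ (Additive.ofMul u) = 0 ↔
      ∃ k : ℤ, (u : AlgebraicClosure (v.adicCompletion K)) =
        algebraMap (v.adicCompletion K) (AlgebraicClosure (v.adicCompletion K)) q₁ ^ k)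
    (hΨ₁ : ∀ (σ : absoluteGaloisGroup (v.adicCompletion K))
        (u : (AlgebraicClosure (v.adicCompletion K))ˣ),
      σ • Ψ₁ (Additive.ofMul u) = ε σ • Ψ₁ (Additive.ofMul (Units.map
        (absoluteGaloisGroup.toAlgEquiv (v.adicCompletion K) σ :
          AlgebraicClosure (v.adicCompletion K) →* AlgebraicClosure (v.adicCompletion K)) u))) :
    Ψ (Additive.ofMul (-1)) = Ψ₁ (Additive.ofMul (-1)) := by
  -- the normed structures: `K_v` with its valuation norm, `K̄_v` with the spectral norm
  letI := GaloisRepresentations.Ultrametric.AdicCompletion.nontriviallyNormedField K v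
  haveI := TateCurve.charZero_adicCompletion' K v
  letI : NontriviallyNormedField (AlgebraicClosure (v.adicCompletion K)) :=
    spectralNorm.nontriviallyNormedField (v.adicCompletion K) (AlgebraicClosure (v.adicCompletion K))
  letI : NormedAlgebra (v.adicCompletion K) (AlgebraicClosure (v.adicCompletion K)) :=
    spectralNorm.normedAlgebra (v.adicCompletion K) (AlgebraicClosure (v.adicCompletion K))
  haveI : CharZero (AlgebraicClosure (v.adicCompletion K)) :=
    charZero_of_injective_algebraMap
      (algebraMap (v.adicCompletion K) (AlgebraicClosure (v.adicCompletion K))).injective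
  have hiso : ∀ (σ : absoluteGaloisGroup (v.adicCompletion K))
      (x : AlgebraicClosure (v.adicCompletion K)),
      ‖absoluteGaloisGroup.toAlgEquiv (v.adicCompletion K) σ x‖ = ‖x‖ := fun σ x =>
    TateCurve.norm_algEquiv_eq (v.adicCompletion K) _ x
  -- the two Tate parameters in `K̄_v`
  have hqn : ‖algebraMap (v.adicCompletion K) (AlgebraicClosure (v.adicCompletion K)) q‖ < 1 := by
    rw [norm_algebraMap']; exact Valued.toNormedField.norm_lt_one_iff.mpr hq
  have hqpos : 0 < ‖algebraMap (v.adicCompletion K) (AlgebraicClosure (v.adicCompletion K)) q‖ :=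
    norm_pos_iff.mpr ((map_ne_zero _).mpr hq0)
  have hq₁n : ‖algebraMap (v.adicCompletion K) (AlgebraicClosure (v.adicCompletion K)) q₁‖ < 1 := by
    rw [norm_algebraMap']; exact Valued.toNormedField.norm_lt_one_iff.mpr hq₁
  have hq₁0' : algebraMap (v.adicCompletion K) (AlgebraicClosure (v.adicCompletion K)) q₁ ≠ 0 :=
    (map_ne_zero _).mpr hq₁0
  have hq₁pos : 0 < ‖algebraMap (v.adicCompletion K) (AlgebraicClosure (v.adicCompletion K)) q₁‖ :=
    norm_pos_iff.mpr hq₁0'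
  -- signs cancel
  have hcancel : ∀ (s : ℤ) (x y : M), (s = 1 ∨ s = -1) → s • x = s • y → x = y := by
    rintro s x y (rfl | rfl) h
    · simpa using h
    · simpa using h
  -- a primitive `2^(n+1)`-th root of unity `ζ ∈ K̄_v`
  haveI : NeZero ((2 : ℕ) : v.adicCompletion K) := NeZero.charZero
  obtain ⟨ζ, hζ⟩ := HasEnoughRootsOfUnity.exists_primitiveRoot
    (AlgebraicClosure (v.adicCompletion K)) (2 ^ (n + 1))
  have hN : 0 < 2 ^ (n + 1) := pow_pos two_pos _
  haveI : NeZero (2 ^ (n + 1)) := ⟨hN.ne'⟩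
  have hζ0 : ζ ≠ 0 := hζ.ne_zero hN.ne'
  set ζu : (AlgebraicClosure (v.adicCompletion K))ˣ := Units.mk0 ζ hζ0 with hζu_def
  have hζu : (ζu : AlgebraicClosure (v.adicCompletion K)) = ζ := rfl
  have hζN : ζu ^ 2 ^ (n + 1) = 1 :=
    Units.ext (by rw [Units.val_pow_eq_pow_val, hζu, hζ.pow_eq_one, Units.val_one])
  have hζhalf : ζu ^ 2 ^ n = -1 :=
    Units.ext (by rw [Units.val_pow_eq_pow_val, hζu,
      pow_eq_neg_one_of_isPrimitiveRoot_two_pow_succ hζ, Units.val_neg, Units.val_one])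
  -- `σ` moving `ζ`: `σ ζ = ζ ^ e`, `e ≠ 1`, `e < 2^(n+1)`
  obtain ⟨σ, hσζ⟩ := exists_toAlgEquiv_apply_ne_of_isPrimitiveRoot v n hroot hζ
  obtain ⟨e, he_lt, he⟩ := hζ.eq_pow_of_pow_eq_one
    (ξ := absoluteGaloisGroup.toAlgEquiv (v.adicCompletion K) σ ζ)
    (by rw [← map_pow, hζ.pow_eq_one, map_one])
  have he1 : e ≠ 1 := by
    rintro rfl
    exact hσζ (by rw [← he, pow_one])
  have hσζu : Units.map (absoluteGaloisGroup.toAlgEquiv (v.adicCompletion K) σ :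
      AlgebraicClosure (v.adicCompletion K) →* AlgebraicClosure (v.adicCompletion K)) ζu = ζu ^ e :=
    Units.ext (by rw [Units.coe_map, MonoidHom.coe_coe, hζu, Units.val_pow_eq_pow_val, hζu, he])
  -- a preimage `u` of `Ψ(ζ)` under `Ψ₁`
  obtain ⟨a, ha⟩ := hsurj₁ (Ψ (Additive.ofMul ζu))
  obtain ⟨u, rfl⟩ : ∃ u : (AlgebraicClosure (v.adicCompletion K))ˣ, Additive.ofMul u = a :=
    ⟨Additive.toMul a, ofMul_toMul a⟩
  -- apply `σ` and cancel the common sign: `Ψ₁(u ^ e) = Ψ₁(σ u)`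
  have h1 : Ψ (Additive.ofMul (Units.map (absoluteGaloisGroup.toAlgEquiv (v.adicCompletion K) σ :
      AlgebraicClosure (v.adicCompletion K) →* AlgebraicClosure (v.adicCompletion K)) ζu)) =
      Ψ₁ (Additive.ofMul (Units.map (absoluteGaloisGroup.toAlgEquiv (v.adicCompletion K) σ :
      AlgebraicClosure (v.adicCompletion K) →* AlgebraicClosure (v.adicCompletion K)) u)) := by
    apply hcancel (ε σ) _ _ (hε σ)
    rw [← hΨ σ ζu, ← hΨ₁ σ u, ha]
  rw [hσζu, ofMul_pow, map_nsmul, ← ha, ← map_nsmul, ← ofMul_pow] at h1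
  have h2 : Ψ₁ (Additive.ofMul (Units.map (absoluteGaloisGroup.toAlgEquiv (v.adicCompletion K) σ :
      AlgebraicClosure (v.adicCompletion K) →* AlgebraicClosure (v.adicCompletion K)) u * (u ^ e)⁻¹))
      = 0 := by
    rw [ofMul_mul, ofMul_inv, map_add, map_neg, ← h1, add_neg_cancel]
  obtain ⟨k, hk⟩ := (hkerΨ₁ _).mp h2
  rw [Units.val_mul, Units.val_inv_eq_inv_val, Units.val_pow_eq_pow_val, Units.coe_map,
    MonoidHom.coe_coe] at hk
  have hk' : absoluteGaloisGroup.toAlgEquiv (v.adicCompletion K) σ (u : AlgebraicClosure (v.adicCompletion K)) =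
      algebraMap (v.adicCompletion K) (AlgebraicClosure (v.adicCompletion K)) q₁ ^ k *
        (u : AlgebraicClosure (v.adicCompletion K)) ^ e := by
    rw [← hk, inv_mul_cancel_right₀ (pow_ne_zero _ u.ne_zero)]
  -- the order relation: `u ^ 2^(n+1) = q₁ ^ m`
  have h3 : Ψ₁ (Additive.ofMul (u ^ 2 ^ (n + 1))) = 0 := by
    rw [ofMul_pow, map_nsmul, ha, ← map_nsmul, ← ofMul_pow, hζN, ofMul_one, map_zero]
  obtain ⟨m, hm⟩ := (hkerΨ₁ _).mp h3
  rw [Units.val_pow_eq_pow_val] at hm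
  -- norms and logarithms
  set r : ℝ := ‖(u : AlgebraicClosure (v.adicCompletion K))‖ with hr_def
  set s : ℝ := ‖algebraMap (v.adicCompletion K) (AlgebraicClosure (v.adicCompletion K)) q₁‖
    with hs_def
  have hr : 0 < r := norm_pos_iff.mpr u.ne_zero
  have hA : r = s ^ k * r ^ e := by
    have h := congrArg norm hk'
    rwa [hiso, norm_mul, norm_zpow, norm_pow] at h
  have hB : r ^ 2 ^ (n + 1) = s ^ m := by
    have h := congrArg norm hm
    rwa [norm_pow, norm_zpow] at h
  have hslog : Real.log s ≠ 0 := (Real.log_neg hq₁pos hq₁n).ne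
  have hlogA : ((e : ℝ) - 1) * Real.log r + k * Real.log s = 0 := by
    have h := congrArg Real.log hA
    rw [Real.log_mul (zpow_ne_zero _ hq₁pos.ne') (pow_ne_zero _ hr.ne'), Real.log_zpow,
      Real.log_pow] at h
    linarith
  have hlogB : (m : ℝ) * Real.log s = (2 : ℝ) ^ (n + 1) * Real.log r := by
    have h := congrArg Real.log hB
    rw [Real.log_pow, Real.log_zpow] at h
    push_cast at h
    linarith
  have hint : ((e : ℤ) - 1) * m + k * 2 ^ (n + 1) = 0 := by
    have h : (((e : ℤ) - 1) * m + k * 2 ^ (n + 1) : ℝ) * Real.log s = 0 := by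
      push_cast
      linear_combination ((e : ℝ) - 1) * hlogB + (2 : ℝ) ^ (n + 1) * hlogA
    rcases mul_eq_zero.mp h with h | h
    · exact_mod_cast h
    · exact absurd h hslog
  -- parity: `m` is even (`2^(n+1) ∣ (e - 1) m` with `0 < |e - 1| < 2^(n+1)`)
  have hmeven : (2 : ℤ) ∣ m := by
    by_contra hodd
    have hcop : Int.gcd (2 ^ (n + 1) : ℤ) m = 1 := by
      rw [Int.gcd_eq_natAbs, Int.natAbs_pow]
      exact (Nat.coprime_two_left.mpr (Int.natAbs_odd.mpr
        (Int.not_even_iff_odd.mp (by rwa [even_iff_two_dvd])))).pow_left _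
    have hdvd : (2 ^ (n + 1) : ℤ) ∣ ((e : ℤ) - 1) * m :=
      ⟨-k, by linear_combination hint⟩
    have hdvd' : (2 ^ (n + 1) : ℤ) ∣ (e : ℤ) - 1 := Int.dvd_of_dvd_mul_left_of_gcd_one hdvd hcop
    obtain ⟨N, hNdef⟩ : ∃ N : ℕ, N = 2 ^ (n + 1) := ⟨_, rfl⟩
    have hN2 : 2 ≤ N := by
      rw [hNdef]
      calc (2 : ℕ) = 2 ^ 1 := (pow_one 2).symm
        _ ≤ 2 ^ (n + 1) := Nat.pow_le_pow_right two_pos (Nat.le_add_left 1 n)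
    rw [← hNdef] at he_lt
    have habs : ((e : ℤ) - 1).natAbs < ((2 : ℤ) ^ (n + 1)).natAbs := by
      rw [Int.natAbs_pow, show ((2 : ℤ).natAbs) = 2 from rfl, ← hNdef]
      omega
    have h0 := Int.eq_zero_of_dvd_of_natAbs_lt_natAbs hdvd' habs
    omega
  obtain ⟨m', hm'⟩ := hmeven
  -- `w = u ^ 2^n · q₁ ^ (-m')` squares to `1`
  set Q₁ : (AlgebraicClosure (v.adicCompletion K))ˣ := Units.mk0 _ hq₁0' with hQ₁_def
  have hΨ₁Q : Ψ₁ (Additive.ofMul Q₁) = 0 := (hkerΨ₁ Q₁).mpr ⟨1, by rw [hQ₁_def, Units.val_mk0, zpow_one]⟩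
  set w : (AlgebraicClosure (v.adicCompletion K))ˣ := u ^ 2 ^ n * Q₁ ^ (-m') with hw_def
  have hw2 : (w : AlgebraicClosure (v.adicCompletion K)) * w = 1 := by
    have hu2 : (u : AlgebraicClosure (v.adicCompletion K)) ^ 2 ^ n * (u : AlgebraicClosure (v.adicCompletion K)) ^ 2 ^ n =
        algebraMap (v.adicCompletion K) (AlgebraicClosure (v.adicCompletion K)) q₁ ^ m := by
      rw [← hm, ← pow_add, ← two_mul, ← pow_succ']
    rw [hw_def, Units.val_mul, Units.val_pow_eq_pow_val, Units.val_zpow_eq_zpow_val, hQ₁_def,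
      Units.val_mk0, mul_mul_mul_comm, hu2, hm', ← zpow_add₀ hq₁0', ← zpow_add₀ hq₁0']
    ring_nf
    exact zpow_zero _
  have hΨ₁w : Ψ₁ (Additive.ofMul w) = Ψ (Additive.ofMul (-1)) := by
    rw [hw_def, ofMul_mul, map_add, ofMul_zpow, map_zsmul, hΨ₁Q, smul_zero, add_zero, ofMul_pow,
      map_nsmul, ha, ← map_nsmul, ← ofMul_pow, hζhalf]
  rcases mul_self_eq_one_iff.mp hw2 with h | h
  · -- `w = 1` would give `Ψ(-1) = 0`, i.e. `-1 ∈ q^ℤ`: impossible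
    exfalso
    have hw1 : w = 1 := Units.ext h
    rw [hw1, ofMul_one, map_zero] at hΨ₁w
    obtain ⟨j, hj⟩ := (hkerΨ (-1)).mp hΨ₁w.symm
    rw [Units.val_neg, Units.val_one] at hj
    have hnorm := congrArg norm hj
    rw [norm_neg, norm_one, norm_zpow] at hnorm
    have hj0 : j = 0 := by
      have h' := congrArg Real.log hnorm
      rw [Real.log_one, Real.log_zpow] at h'
      have hqlog : Real.log ‖algebraMap (v.adicCompletion K)
          (AlgebraicClosure (v.adicCompletion K)) q‖ ≠ 0 := (Real.log_neg hqpos hqn).ne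
      exact_mod_cast (mul_eq_zero.mp h'.symm).resolve_right hqlog
    rw [hj0, zpow_zero] at hj
    exact absurd hj (by norm_num)
  · have hw1 : w = -1 := Units.ext (by rw [h, Units.val_neg, Units.val_one])
    rw [hw1] at hΨ₁w
    exact hΨ₁w.symm

end Rigidity

end Literature.NumberTheory.EllipticCurves.Greenberg1999

end
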